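import Literature.NumberTheory.Rogawski1990.FlickerScalarsTraceCM                    -- ★ (K1)-on-`E_v` + the package `exists_traceFrame_scalars_of_nonsplit{,'}`; brings ★ `WildSeamDockings` (K1), ★ `LocalRing.eq_iff_apply_eq`
import Literature.NumberTheory.LocalFields.UnramifiedQuadraticNormAtInertPlaceValued  -- ★ `exists_galAdicCompletionMap_eq_neg_valued_eq_one` (a `σ_w`-skew UNIT at an inert unramified place)
import HarnessLib

/-!
# The SHARP trace seed at an inert unramified CM place: `b + σb = 1`, `|b_w|_w = 1` AND `|σb − b|_w = 1` — every residue characteristic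
# (Serre 1979 V §2 Prop. 3; Jacobowitz 1962 §7; Flicker 1998 §2 Prop. 3)

Topic `NumberTheory/Rogawski1990`; namespace `Literature.NumberTheory.Rogawski1990`.  **Theorems only** (no `def`, no instance, no notation, no named fact,
no `sorry`); count-neutral; kernel lane `--supports stmt-HodgeConjecture-24833`.  Cell `pub/hodgecm-mathlib`, crux H413; LH4-plan (g7) WORD #10 ruling R2 ∕
deal (g) «T7 SUPPLIER» (seat LH7-p03 (g5)): the LAYER C files (C3b)–(C3e), (C4), (C5) and the (C6) readers carry the NEW leading binder
**T7 `(hbδ : Valued.v (σ b − b) = 1)`** next to `hbv` — the trace seed `b` (`b + σb = 1`) must be a unit WHOSE SKEW PART `σb − b = 1 − 2b` IS ALSO A UNIT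
(residually: `b̄ ∉ k_v`).  This file SUPPLIES such a `b` on the CM carrier `E_v = L ⊗ L⁺_v = LocalRing L v` (`σ = conjLocal`), at a finite place `v` of `L⁺`
NON-SPLIT (`c • w = w`) and UNRAMIFIED in `L`, with NO hypothesis on the residue characteristic, and re-issues the ★ package
`FlickerScalarsTraceCM.exists_traceFrame_scalars_of_nonsplit{,'}` with the ONE extra conjunct.  NOT an edition of ★ `FlickerScalarsTraceCM` (new file, new names).

THE MATHEMATICS (`K = L_w`, `σ = σ_w` an isometric involution, `k_w ⊋ k_v` the residue fields).  Any `b` with `b + σb = 1` and `|b| ≤ 1` is a unit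
(`1 = |b + σb| ≤ max (|b|, |σb|) = |b|`).  DYADIC `v` (`|2|_w < 1`): `σb − b = 1 − 2b` and `|2b| < 1`, so `|σb − b| = 1` for EVERY trace seed — take ★ (K1)'s.
ODD `v` (`|2|_w = 1`): ★ (K1)'s seed may be `≡ ½ (mod 𝔭_w)`; take instead `b := (1 + δ)·2⁻¹` for a `σ`-SKEW UNIT `δ` (`σδ = −δ`, `|δ| = 1`, ★
`exists_galAdicCompletionMap_eq_neg_valued_eq_one`: `δ = σa − a` for an integer `a` whose residue Frobenius moves): `b + σb = (1 + δ + 1 − δ)·2⁻¹ = 1`,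
`σb − b = −δ` a unit, and `|b| = 1` by the first remark.  The `E_v`-level statement is read on the one factor `E_w` of `E_v` (`(σx)_w = σ_w(x_w)`, ★
`LocalRing.eq_iff_apply_eq`), exactly as ★ (K1)-on-`E_v` was.

* §0 generic (`K` a valued field, `σ` an isometry): `valued_eq_one_of_add_map_eq_one` (trace seeds in `𝒪` are units), `valued_map_sub_self_eq_one_of_valued_two_lt_one`
  (dyadic: the skew part of a trace seed is a unit), `exists_add_map_eq_one_sharp_of_valued_two_eq_one` (odd: `(1 + δ)∕2`), `exists_add_map_eq_one_sharp` (both).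
* §1 `exists_add_conjLocal_eq_one_sharp` — **(K1♯)** `∃ b ∈ E_v`, `b + σb = 1`, `|b_w|_w = 1`, `|(σb − b)_w|_w = 1`.
* §2 `exists_traceFrame_scalars_of_nonsplit_sharp` ∕ `…_sharp'` — ★ :158 ∕ :176 with the extra conjunct `Valued.v ((σ b − b) w) = 1` placed right after `Valued.v (b w) = 1`.

HONEST LABEL: count-neutral ((D-UNR) stays PRINT by D74′; this is the `hbδ`-supplier of the in-house type-(1) trace-frame layer); HC_CM is proved only modulo the 7
printed citations (2 remaining: hLiu418 = `stmt-HodgeConjecture-24832`, h413 = `stmt-HodgeConjecture-24833`) until rung 0 closes.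

## References
* [Serre1979] J.-P. Serre, *Local Fields* (1979), Ch. V §2 Prop. 3 (unramified extensions: the residue extension is separable of the same degree; the trace is surjective).
* [Jacobowitz1962] R. Jacobowitz, *Hermitian forms over local fields*, Amer. J. Math. 84 (1962), §7 Thm. 7.1 (trace condition at unramified dyadic places).
* [Flicker1998UnitaryFL] Y. Z. Flicker, *Elementary proof of the fundamental lemma for a unitary group*, Canad. J. Math. 50 (1998), §2 Prop. 3 pp. 78–79.
* [Omeara1963] O. T. O'Meara, *Introduction to Quadratic Forms* (1963), §63C Example 63:16.
-/

set_option autoImplicit false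

noncomputable section

open NumberField IsDedekindDomain

namespace Literature.NumberTheory.Rogawski1990

open Literature.NumberTheory.Automorphic Literature.NumberTheory.Automorphic.UnitaryGroup
open Literature.NumberTheory.QuadraticForms Literature.NumberTheory.NumberFields Literature.NumberTheory.GaloisRepresentations
open Literature.NumberTheory.LocalFields.UnramifiedQuadraticNorm

/-! ## §0 Generic: trace seeds over a valued field with an isometric ring endomorphism `σ` -/

section Generic

variable {K : Type*} [Field K] {Γ₀ : Type*} [LinearOrderedCommGroupWithZero Γ₀] [Valued K Γ₀] (σ : K →+* K)
  (hσv : ∀ x, Valued.v (σ x) = Valued.v x)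

include hσv in
/-- **A trace seed in `𝒪` is a unit**: `b + σb = 1`, `|b| ≤ 1`, `σ` an isometry ⇒ `|b| = 1` (`1 = |b + σb| ≤ max (|b|, |σb|) = |b|`).
[cite: Serre1979, Ch. V §2 Prop. 3] -/
theorem valued_eq_one_of_add_map_eq_one {b : K} (hb : b + σ b = 1) (hb1 : Valued.v b ≤ 1) : Valued.v b = 1 := by
  refine le_antisymm hb1 ?_
  have h : Valued.v (b + σ b) ≤ max (Valued.v b) (Valued.v (σ b)) := Valuation.map_add _ _ _
  rw [hb, Valuation.map_one, hσv, max_self] at h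
  exact h

/-- **DYADIC places — the skew part of a trace seed is a unit for free**: `|2| < 1`, `b + σb = 1`, `|b| ≤ 1` ⇒ `|σb − b| = |1 − 2b| = 1`.
[cite: Jacobowitz1962, §7 Thm. 7.1] [cite: Serre1979, Ch. V §2 Prop. 3] -/
theorem valued_map_sub_self_eq_one_of_valued_two_lt_one (h2 : Valued.v (2 : K) < 1) {b : K} (hb : b + σ b = 1) (hb1 : Valued.v b ≤ 1) :
    Valued.v (σ b - b) = 1 := by
  have hσb : σ b = 1 - b := by rw [← hb]; ring
  have h2b : Valued.v (2 * b) < 1 := by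
    rw [Valuation.map_mul]
    exact lt_of_le_of_lt (mul_le_of_le_one_right' hb1) h2
  rw [hσb, show (1 : K) - b - b = 1 - 2 * b by ring]
  exact Valuation.map_one_sub_of_lt _ h2b

include hσv in
/-- **ODD places — the seed `(1 + δ)∕2`**: `|2| = 1` and `δ` a `σ`-skew unit (`σδ = −δ`, `|δ| = 1`) ⇒ `b := (1 + δ)·2⁻¹` has `b + σb = 1`, `|b| = 1`, `σb − b = −δ` of
absolute value `1`. [cite: Serre1979, Ch. V §2 Prop. 3] [cite: Flicker1998UnitaryFL, §2 Prop. 3 p. 78] -/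
theorem exists_add_map_eq_one_sharp_of_valued_two_eq_one (h2 : Valued.v (2 : K) = 1) {δ : K} (hσδ : σ δ = -δ) (hvδ : Valued.v δ = 1) :
    ∃ b : K, b + σ b = 1 ∧ Valued.v b = 1 ∧ Valued.v (σ b - b) = 1 := by
  have h20 : (2 : K) ≠ 0 := fun h => by rw [h, Valuation.map_zero] at h2; exact zero_ne_one h2
  have hσ2 : σ (2 : K)⁻¹ = (2 : K)⁻¹ := by rw [map_inv₀, map_ofNat]
  refine ⟨(1 + δ) * (2 : K)⁻¹, ?_, ?_, ?_⟩
  · rw [map_mul, map_add, map_one, hσδ, hσ2, ← add_mul, show (1 : K) + δ + (1 + -δ) = 2 by ring, mul_inv_cancel₀ h20]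
  · refine valued_eq_one_of_add_map_eq_one σ hσv ?_ ?_
    · rw [map_mul, map_add, map_one, hσδ, hσ2, ← add_mul, show (1 : K) + δ + (1 + -δ) = 2 by ring, mul_inv_cancel₀ h20]
    · rw [Valuation.map_mul, Valuation.map_inv, h2, inv_one, mul_one]
      exact (Valuation.map_add _ _ _).trans (max_le (le_of_eq (Valuation.map_one _)) hvδ.le)
  · rw [map_mul, map_add, map_one, hσδ, hσ2, ← sub_mul, show (1 : K) + -δ - (1 + δ) = -δ * 2 by ring, mul_assoc, mul_inv_cancel₀ h20, mul_one,
      Valuation.map_neg, hvδ]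

include hσv in
/-- **THE SHARP SEED, both parities**: `σ` an isometry, `|2| ≤ 1`; given ANY unit trace seed (`b₀ + σb₀ = 1`, `|b₀| = 1` — used at dyadic places) and ANY `σ`-skew unit
`δ` (used at odd places), there is `b` with `b + σb = 1`, `|b| = 1`, `|σb − b| = 1`. [cite: Serre1979, Ch. V §2 Prop. 3] [cite: Jacobowitz1962, §7 Thm. 7.1] -/
theorem exists_add_map_eq_one_sharp (h2 : Valued.v (2 : K) ≤ 1) {b₀ : K} (hb₀ : b₀ + σ b₀ = 1) (hvb₀ : Valued.v b₀ = 1)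
    {δ : K} (hσδ : σ δ = -δ) (hvδ : Valued.v δ = 1) :
    ∃ b : K, b + σ b = 1 ∧ Valued.v b = 1 ∧ Valued.v (σ b - b) = 1 := by
  rcases h2.lt_or_eq with h2 | h2
  · exact ⟨b₀, hb₀, hvb₀, valued_map_sub_self_eq_one_of_valued_two_lt_one σ h2 hb₀ hvb₀.le⟩
  · exact exists_add_map_eq_one_sharp_of_valued_two_eq_one σ hσv h2 hσδ hvδ

end Generic

/-! ## §1 (K1♯) The sharp trace seed on `E_v` at a non-split unramified CM place -/

variable (L : Type) [Field L] [NumberField L] [IsCMField L] (v : HeightOneSpectrum (𝓞 ↥(maximalRealSubfield L)))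
  (w : PlacesOver L v) (hw : IsCMField.complexConj L • w.1 = w.1)

include hw in
/-- `(σ x)_w = σ_w (x_w)`: `conjLocal` at the unique place above a non-split `v` is the Galois transport on that factor (★ `conjLocal_apply`, one place above `v`;
a `private` copy of the `private` ★ `FlickerScalarsTraceCM.conjLocal_apply_of_smul_eq_cm`, kept local for the same reason). [cite: Omeara1963, §63C Example 63:16] -/
private theorem conjLocal_apply_of_smul_eq_sharp (x : LocalRing L v) :
    conjLocal L (IsCMField.complexConj L) v x w = galAdicCompletionMap (L := L) (IsCMField.complexConj L) hw (x w) := by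
  have key : ∀ (w₁ : PlacesOver L v) (h₁ : IsCMField.complexConj L • w₁.1 = w.1),
      galAdicCompletionMap (L := L) (IsCMField.complexConj L) h₁ (x w₁) = galAdicCompletionMap (L := L) (IsCMField.complexConj L) hw (x w) := by
    intro w₁ h₁
    have e : w₁ = w := PlacesOver.eq_of_smul_eq (IsCMField.complexConj L) (IsCMField.complexConj_ne_one L) w hw w₁
    subst e
    rfl
  rw [conjLocal_apply]
  exact key ⟨(IsCMField.complexConj L)⁻¹ • w.1, under_inv_smul_eq (IsCMField.complexConj L) w⟩ (smul_inv_smul (IsCMField.complexConj L) w.1)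

include hw in
/-- **(K1♯) THE SHARP TRACE SEED ON `E_v`**: at a finite place `v` of `L⁺` non-split and unramified in `L` there is `b ∈ E_v = L ⊗ L⁺_v` with `b + σb = 1` whose
`w`-component AND whose skew part's `w`-component are UNITS: `|b_w|_w = 1`, `|(σb − b)_w|_w = |1 − 2 b_w|_w = 1` — ★ (K1) (`WildSeamDockings`) at dyadic `v`, `(1 + δ)∕2`
for a `σ_w`-skew unit `δ` (★ `exists_galAdicCompletionMap_eq_neg_valued_eq_one`) at odd `v`, read on the one factor `E_w` of `E_v`.  Supplies the T7 binder `hbδ` of the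
trace-frame layer (LH4-plan (g7) WORD #10 R2). [cite: Serre1979, Ch. V §2 Prop. 3] [cite: Jacobowitz1962, §7 Thm. 7.1] [cite: Flicker1998UnitaryFL, §2 Prop. 3 pp. 78–79] -/
theorem exists_add_conjLocal_eq_one_sharp (hunr : Algebra.IsUnramifiedIn (𝓞 L) v.asIdeal) :
    ∃ b : LocalRing L v, b + conjLocal L (IsCMField.complexConj L) v b = 1 ∧ Valued.v (b w) = 1 ∧
      Valued.v ((conjLocal L (IsCMField.complexConj L) v b - b) w) = 1 := by
  haveI : Algebra.IsQuadraticExtension ↥(maximalRealSubfield L) L := IsCMField.isQuadraticExtension L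
  have hcc : IsCMField.complexConj L * IsCMField.complexConj L = 1 := AlgEquiv.ext fun y => IsCMField.complexConj_apply_apply L y
  -- on the factor `E_w`: ★ (K1)'s unit seed, a ★ skew unit, `σ_w` an isometry, `|2|_w ≤ 1`
  obtain ⟨b₀, hvb₀, hb₀⟩ := WildSeamDockings.exists_v_eq_one_add_galAdicCompletionMap_eq_one (IsCMField.complexConj L) w
    (IsCMField.complexConj_ne_one L) hw hunr
  obtain ⟨δ, hσδ, hvδ⟩ := exists_galAdicCompletionMap_eq_neg_valued_eq_one (IsCMField.complexConj L) v (IsCMField.complexConj_ne_one L) hcc hunr w hw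
  have hσv : ∀ x, Valued.v (galAdicCompletionMap (L := L) (IsCMField.complexConj L) hw x) = Valued.v x :=
    fun x => valued_galAdicCompletionMap (L := L) (IsCMField.complexConj L) hw x
  have h2 : Valued.v (2 : w.1.adicCompletion L) ≤ 1 := by
    rw [show (2 : w.1.adicCompletion L) = 1 + 1 by norm_num]
    exact (Valuation.map_add _ _ _).trans (max_le (le_of_eq (Valuation.map_one _)) (le_of_eq (Valuation.map_one _)))
  obtain ⟨b₁, hb₁, hvb₁, hbδ₁⟩ := exists_add_map_eq_one_sharp (galAdicCompletionMap (L := L) (IsCMField.complexConj L) hw) hσv h2 hb₀ hvb₀ hσδ hvδ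
  -- the element of `E_v = Π_{w' ∣ v} L_{w'}` with `w`-component `b₁` (one factor)
  haveI : Subsingleton (PlacesOver L v) := PlacesOver.subsingleton_of_smul_eq (IsCMField.complexConj L) (IsCMField.complexConj_ne_one L) w hw
  letI : Unique (PlacesOver L v) := uniqueOfSubsingleton w
  let π : LocalRing L v ≃+* w.1.adicCompletion L := RingEquiv.piUnique fun w' : PlacesOver L v => w'.1.adicCompletion L
  obtain ⟨b, hbw⟩ : ∃ b : LocalRing L v, b w = b₁ := ⟨π.symm b₁, π.apply_symm_apply b₁⟩
  refine ⟨b, ?_, by rw [hbw]; exact hvb₁, ?_⟩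
  · rw [LocalRing.eq_iff_apply_eq (IsCMField.complexConj L) (IsCMField.complexConj_ne_one L) w hw, Pi.add_apply,
      conjLocal_apply_of_smul_eq_sharp L v w hw, hbw, Pi.one_apply]
    exact hb₁
  · rw [Pi.sub_apply, conjLocal_apply_of_smul_eq_sharp L v w hw, hbw]
    exact hbδ₁

/-! ## §2 The package with the sharp seed -/

include hw in
/-- **THE 2-FREE SCALARS OF THE TRACE FRAME, SHARP SEED** (= ★ `exists_traceFrame_scalars_of_nonsplit` with the ONE extra conjunct `|(σb − b)_w|_w = 1` after
`|b_w|_w = 1`): at a finite place `v` of `L⁺` non-split and unramified in `L`, on `E_v = L ⊗ L⁺_v` with `σ = conjLocal`, there are `b π ε` with: `b + σb = 1`,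
`|b_w|_w = 1`, `|(σb − b)_w|_w = 1` ((K1♯)); `σπ = π`, `π` a unit, `σz·z ≠ π` for all `z`, `π = ι_v(ϖ_v)`, `|π_w|_w = exp(−1)`; `σε·ε = −1` — the binders
`hb hbv hbδ hσπ hπN hε` of the trace-frame literal layer with T7, at EVERY residue characteristic. [cite: Flicker1998UnitaryFL, §2 Prop. 3 pp. 78–79]
[cite: Jacobowitz1962, §7 Thm. 7.1] [cite: Omeara1963, §63C Example 63:16] [cite: Serre1979, Ch. V §2 Prop. 3] -/
theorem exists_traceFrame_scalars_of_nonsplit_sharp (hunr : Algebra.IsUnramifiedIn (𝓞 L) v.asIdeal) :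
    ∃ b π ε : LocalRing L v,
      b + conjLocal L (IsCMField.complexConj L) v b = 1 ∧ Valued.v (b w) = 1 ∧
      Valued.v ((conjLocal L (IsCMField.complexConj L) v b - b) w) = 1 ∧
      conjLocal L (IsCMField.complexConj L) v π = π ∧ IsUnit π ∧ (∀ z : LocalRing L v, conjLocal L (IsCMField.complexConj L) v z * z ≠ π) ∧
      π = toLocalRing L v (HeckeCharacter.uniformizer ↥(maximalRealSubfield L) v : v.adicCompletion ↥(maximalRealSubfield L)) ∧
      Valued.v (π w) = WithZero.exp (-1 : ℤ) ∧
      conjLocal L (IsCMField.complexConj L) v ε * ε = -1 := by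
  obtain ⟨-, π, ε, -, -, hσπ, hπu, hπN, hπeq, hvπ, hε⟩ := exists_traceFrame_scalars_of_nonsplit L v w hw hunr
  obtain ⟨b, hb, hvb, hbδ⟩ := exists_add_conjLocal_eq_one_sharp L v w hw hunr
  exact ⟨b, π, ε, hb, hvb, hbδ, hσπ, hπu, hπN, hπeq, hvπ, hε⟩

include hw in
/-- **The `π π′ = 1` form** of the sharp package (= ★ `exists_traceFrame_scalars_of_nonsplit'` with the ONE extra conjunct `|(σb − b)_w|_w = 1` after `|b_w|_w = 1`):
`∃ b π π′ ε` with `b + σb = 1`, `|b_w|_w = 1`, `|(σb − b)_w|_w = 1`, `σπ = π`, `π π′ = 1`, `σz·z ≠ π`, `|π_w|_w = exp(−1)`, `σε·ε = −1`.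
[cite: Flicker1998UnitaryFL, §2 Prop. 3 pp. 78–79] [cite: Omeara1963, §63C Example 63:16] -/
theorem exists_traceFrame_scalars_of_nonsplit_sharp' (hunr : Algebra.IsUnramifiedIn (𝓞 L) v.asIdeal) :
    ∃ b π π' ε : LocalRing L v,
      b + conjLocal L (IsCMField.complexConj L) v b = 1 ∧ Valued.v (b w) = 1 ∧
      Valued.v ((conjLocal L (IsCMField.complexConj L) v b - b) w) = 1 ∧
      conjLocal L (IsCMField.complexConj L) v π = π ∧ π * π' = 1 ∧ (∀ z : LocalRing L v, conjLocal L (IsCMField.complexConj L) v z * z ≠ π) ∧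
      Valued.v (π w) = WithZero.exp (-1 : ℤ) ∧
      conjLocal L (IsCMField.complexConj L) v ε * ε = -1 := by
  obtain ⟨b, π, ε, hb, hvb, hbδ, hσπ, hπu, hπN, -, hvπ, hε⟩ := exists_traceFrame_scalars_of_nonsplit_sharp L v w hw hunr
  obtain ⟨π', hππ'⟩ := hπu.exists_right_inv
  exact ⟨b, π, π', ε, hb, hvb, hbδ, hσπ, hππ', hπN, hvπ, hε⟩

end Literature.NumberTheory.Rogawski1990
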